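import Summits.ValiantsHypothesis.ValiantsHypothesis.Theorems.FifoMatchingNNDivisionHardLocalizationRoot
import Summits.ValiantsHypothesis.ValiantsHypothesis.Theorems.FifoMatchingNNDivisionHardLocalizationFace

/-!
# FifoMatching · NNDivisionHard — localization, part 8: §B2–§B3 free-face SPECIES (stable-set / contraction faces, two-scale tops) and the composite `Face ∘ AutStar`

Theorems-grade port (bytes staged by val-idea-43 g6 for a port hand) of the crux workfile `Cruxes/NNDivisionHard/Symmetry43.lean`
@1a81e50299bb (sha16 761689e21b9c70ce, 795 l.; val-idea-43 g6, crux `stmt-ValiantsHypothesis-21181` `FifoMatching.NNDivisionHard`; critic of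
record val-idea-crit-9 g3 V#97 §4: (A) «NEW (functor): GO», (B) «NEW (functor): GO WITH PRIORITY — the GENUS-I functor», (C) fold into (B)) —
statements and proofs VERBATIM, namespace `…Theorems.FifoMatching.Localization` (continues parts 1–5 ✓ `…Localization{,Deletion,Switching,Sieve,Orbit}`).

Part 8.  NEW members of the free-face genus: STABLE-SET faces `{b_j b_k = 0 ∀ (j,k) ∈ E′}` read on any `ι` meeting no position of `E′` twice
(`stableFun`, `stable_free`, ★ `face_of_stable`; pins `(x₀,x₀) ∈ E′` included; `E′ = ∅` is `Loc`) and the CONTRACTION (agreement) faces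
`{b_x = b_y}` of `CUT□_{h+1}` read off `y` (`agreeFun`, `agreeFun_corVec` = `−[b_x ≠ b_y]`, `agree_free`, ★ `face_of_agree`) — not apex pins,
outside the deletion/switching calculus (N19 had deletions only).  §B3 (crit-9 g3 V#97 §4's one price on (B)): `Face` quantifies `∃ w` PER
FAMILY, so TWO-SCALE functionals `λ·w₀ + v` with `v` constant on the tight set of `w₀` and `λ = λ(q)` (`exists_scale` over the finite index
type `(Fin h → Bool) ⊕ (Fin (K'+1) × Fin (K+1))`) ARE instances: ★ `face_of_twoScale` (top generators = the LEXICOGRAPHIC `(w₀, v)`-tops),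
★ `faceQuiet_of_twoScaleTop` (lexicographic unique top ⇒ `Face Quiet`; the ELEVEN / TWELVE shape of CRITIC-wave7).  Composite with part 6:
★★ `decided_face_autStar`, glue ★★★ `corVirtualHard_of_residualLawFaceAutStar` (`CoreLawFace`-shape for the pen's rev 22: the residual law
outside `Face (AutStar X)` suffices), honesty chain `residualLaw_faceAutStar_of_orbStar` (`OrbStar X ≤ AutStar X ≤ Face (AutStar X)`).

Honest label: TEMPLATE + named decided species for the TOP cone; NOT progress on `C′ = ExactPencilLaw` nor on `CoreLawOrb`; 0 explicit residual
members before and after; 21181 OPEN; VP ≠ VNP NOT proved.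
-/

set_option linter.unusedVariables false
set_option linter.unusedSectionVars false
set_option linter.dupNamespace false

namespace Summit.ValiantsHypothesis.ValiantsHypothesis.Theorems.FifoMatching.Localization

open Matrix Finset
open scoped Pointwise
open Literature.Barriers.PneNP (HasEFOfSize)
open Literature.Combinatorics.Optimization (corPolytopeGraph corVec)

/-! ### §B2 (continued) STABLE-SET faces (pins included) and CONTRACTION faces -/

/-- the STABLE-SET functional of a set `E′` of positions: `−𝟙_{E′}`. -/
def stableFun {h : ℕ} (E' : Finset (Fin h × Fin h)) : Fin h × Fin h → ℝ := fun p => if p ∈ E' then -1 else 0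

/-- `−𝟙_{E′} ⬝ y = −Σ_{p ∈ E′} y p`. -/
theorem stableFun_dotProduct {h : ℕ} (E' : Finset (Fin h × Fin h)) (y : Fin h × Fin h → ℝ) :
    stableFun E' ⬝ᵥ y = -∑ p ∈ E', y p := by
  simp only [stableFun, dotProduct]
  rw [← Finset.sum_neg_distrib, ← Finset.sum_subset (Finset.subset_univ E')]
  · exact Finset.sum_congr rfl fun p hp => by rw [if_pos hp]; ring
  · intro p _ hp
    rw [if_neg hp]; ring

/-- `−𝟙_{E′}` is valid on `COR(K_h)` with bound `0` … -/
theorem stableFun_corVec_le {h : ℕ} (E' : Finset (Fin h × Fin h)) (b : Fin h → Bool) :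
    stableFun E' ⬝ᵥ corVec (⊤ : SimpleGraph (Fin h)) b ≤ 0 := by
  rw [stableFun_dotProduct, neg_nonpos]
  exact Finset.sum_nonneg fun p _ => corVec_top_nonneg b p

/-- … and TIGHT exactly on the `b` avoiding `E′` (`b_j b_k = 0` for `(j,k) ∈ E′`; a diagonal position `(x₀,x₀) ∈ E′` is the PIN `b_{x₀} = 0`). -/
theorem stableFun_corVec_eq_zero {h : ℕ} (E' : Finset (Fin h × Fin h)) (b : Fin h → Bool)
    (hb : ∀ p ∈ E', b p.1 = false ∨ b p.2 = false) : stableFun E' ⬝ᵥ corVec (⊤ : SimpleGraph (Fin h)) b = 0 := by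
  rw [stableFun_dotProduct, neg_eq_zero]
  refine Finset.sum_eq_zero fun p hp => ?_
  rcases hb p hp with h1 | h1
  · exact corVec_top_eq_zero_of_fst b p.2 h1
  · exact corVec_top_eq_zero_of_snd b p.1 h1

/-- a coordinate set meeting no position of `E′` twice is FREE for the stable-set face (extend by `0`). -/
theorem stable_free {h ℓ : ℕ} (E' : Finset (Fin h × Fin h)) (ι : Fin ℓ ↪ Fin h)
    (hind : ∀ p ∈ E', (∀ a, ι a ≠ p.1) ∨ (∀ a, ι a ≠ p.2)) (c : Fin ℓ → Bool) :
    ∃ b : Fin h → Bool, stableFun E' ⬝ᵥ corVec (⊤ : SimpleGraph (Fin h)) b = 0 ∧ b ∘ ι = c := by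
  refine ⟨Function.extend ι c (fun _ => false), stableFun_corVec_eq_zero E' _ fun p hp => ?_, ?_⟩
  · rcases hind p hp with h1 | h1
    · exact Or.inl (by rw [Function.extend_apply' _ _ _ (fun ⟨a, ha⟩ => h1 a ha)])
    · exact Or.inr (by rw [Function.extend_apply' _ _ _ (fun ⟨a, ha⟩ => h1 a ha)])
  · funext a
    exact ι.injective.extend_apply _ _ a

/-- ★ **STABLE-SET FACES**: if the generators maximising `−Σ_{(j,k) ∈ E′} q(j,k)`, read on a coordinate set `ι` (`⌊√h⌋ ≤ ℓ`) meeting no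
position of `E′` twice, form a family in `X`, then `q ∈ Face X`.  (`E′ = ∅`: `Loc`; `E′ = {(x₀,x₀)}`, `ι` = skip `x₀`: the deletion-located
shape; `E′` = a sparse graph, `ι` = an independent set: NEW.) -/
theorem face_of_stable {X : PClass} {h ℓ K K' : ℕ} (q : Fam h K) (E' : Finset (Fin h × Fin h)) (hℓ : Nat.sqrt h ≤ ℓ)
    (ι : Fin ℓ ↪ Fin h) (hind : ∀ p ∈ E', (∀ a, ι a ≠ p.1) ∨ (∀ a, ι a ≠ p.2)) (e : Fin (K' + 1) → Fin (K + 1))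
    (he₁ : ∀ j' k, stableFun E' ⬝ᵥ q k ≤ stableFun E' ⬝ᵥ q (e j'))
    (he₂ : ∀ j, (∀ k, stableFun E' ⬝ᵥ q k ≤ stableFun E' ⬝ᵥ q j) → ∃ j', q (e j') = q j)
    (hx : X ℓ K' (⇑(delRead ι) ∘ q ∘ e)) : Face X h K q :=
  ⟨ℓ, hℓ, ι, stableFun E', 0, stableFun_corVec_le E', stable_free E' ι hind, K', e, he₁, he₂, hx⟩

/-- the AGREEMENT functional of the pair `x ≠ y`: `−(E_xx + E_yy) + (E_xy + E_yx)`; on `COR` it is `−[b_x ≠ b_y]`. -/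
def agreeFun {h : ℕ} (x y : Fin h) : Fin h × Fin h → ℝ := fun p =>
  if p = (x, x) ∨ p = (y, y) then -1 else if p = (x, y) ∨ p = (y, x) then 1 else 0

/-- `agreeFun x y ⬝ v = −v(x,x) − v(y,y) + v(x,y) + v(y,x)`. -/
theorem agreeFun_dotProduct {h : ℕ} {x y : Fin h} (hxy : x ≠ y) (v : Fin h × Fin h → ℝ) :
    agreeFun x y ⬝ᵥ v = -v (x, x) - v (y, y) + v (x, y) + v (y, x) := by
  unfold agreeFun dotProduct
  have key : ∀ p : Fin h × Fin h,
      (if p = (x, x) ∨ p = (y, y) then (-1 : ℝ) else if p = (x, y) ∨ p = (y, x) then 1 else 0) * v p =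
        (if p = (x, x) then -v (x, x) else 0) + (if p = (y, y) then -v (y, y) else 0) +
          (if p = (x, y) then v (x, y) else 0) + (if p = (y, x) then v (y, x) else 0) := by
    intro p
    by_cases h1 : p = (x, x)
    · subst h1; simp [hxy]
    by_cases h2 : p = (y, y)
    · subst h2; simp [Ne.symm hxy]
    by_cases h3 : p = (x, y)
    · subst h3; simp [hxy, Ne.symm hxy]
    by_cases h4 : p = (y, x)
    · subst h4; simp [hxy, Ne.symm hxy]
    simp [h1, h2, h3, h4]
  simp_rw [key]
  simp only [Finset.sum_add_distrib, Finset.sum_ite_eq', Finset.mem_univ, if_true]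
  ring

/-- `agreeFun x y ⬝ bbᵀ = −[b_x ≠ b_y]`: valid with bound `0`, tight exactly on the AGREEMENT (contraction) face `{b_x = b_y}`. -/
theorem agreeFun_corVec {h : ℕ} {x y : Fin h} (hxy : x ≠ y) (b : Fin h → Bool) :
    agreeFun x y ⬝ᵥ corVec (⊤ : SimpleGraph (Fin h)) b = if b x = b y then 0 else -1 := by
  rw [agreeFun_dotProduct hxy, corVec_top_apply, corVec_top_apply, corVec_top_apply, corVec_top_apply]
  cases b x <;> cases b y <;> norm_num

/-- the agreement functional is valid on `COR(K_h)` with bound `0`. -/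
theorem agreeFun_corVec_le {h : ℕ} {x y : Fin h} (hxy : x ≠ y) (b : Fin h → Bool) :
    agreeFun x y ⬝ᵥ corVec (⊤ : SimpleGraph (Fin h)) b ≤ 0 := by
  rw [agreeFun_corVec hxy]; split_ifs <;> norm_num

/-- every coordinate set avoiding `y` is FREE for the agreement face `{b_x = b_y}` (extend, then copy `b_x` into `y`). -/
theorem agree_free {h ℓ : ℕ} {x y : Fin h} (hxy : x ≠ y) (ι : Fin ℓ ↪ Fin h) (hy : ∀ a, ι a ≠ y) (c : Fin ℓ → Bool) :
    ∃ b : Fin h → Bool, agreeFun x y ⬝ᵥ corVec (⊤ : SimpleGraph (Fin h)) b = 0 ∧ b ∘ ι = c := by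
  let b₀ : Fin h → Bool := Function.extend ι c (fun _ => false)
  refine ⟨Function.update b₀ y (b₀ x), ?_, ?_⟩
  · rw [agreeFun_corVec hxy, Function.update_self, Function.update_of_ne hxy, if_pos rfl]
  · funext a
    show Function.update b₀ y (b₀ x) (ι a) = c a
    rw [Function.update_of_ne (hy a)]
    exact ι.injective.extend_apply _ _ a

/-- ★ **CONTRACTION (AGREEMENT) FACES**: if the generators maximising `q(x,y) + q(y,x) − q(x,x) − q(y,y)`, read on a coordinate set avoiding
`y` (`⌊√h⌋ ≤ ℓ`), form a family in `X`, then `q ∈ Face X` — the contraction of the edge `{x,y}` of `K_{h+1}` (`CUT□_{h+1} ∩ {z_xy = 0}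
≅ CUT□_h`), which is NOT an apex pin, hence outside the deletion/switching calculus in general. -/
theorem face_of_agree {X : PClass} {h ℓ K K' : ℕ} (q : Fam h K) {x y : Fin h} (hxy : x ≠ y) (hℓ : Nat.sqrt h ≤ ℓ)
    (ι : Fin ℓ ↪ Fin h) (hy : ∀ a, ι a ≠ y) (e : Fin (K' + 1) → Fin (K + 1))
    (he₁ : ∀ j' k, agreeFun x y ⬝ᵥ q k ≤ agreeFun x y ⬝ᵥ q (e j'))
    (he₂ : ∀ j, (∀ k, agreeFun x y ⬝ᵥ q k ≤ agreeFun x y ⬝ᵥ q j) → ∃ j', q (e j') = q j)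
    (hx : X ℓ K' (⇑(delRead ι) ∘ q ∘ e)) : Face X h K q :=
  ⟨ℓ, hℓ, ι, agreeFun x y, 0, agreeFun_corVec_le hxy, agree_free hxy ι hy, K', e, he₁, he₂, hx⟩

/-! ### §B3 TWO-SCALE (lexicographic) tops ARE instances (crit-9 g3 V#97 §4 price on (B))

`Face` quantifies `∃ w` PER FAMILY, so a two-scale functional `λ·w₀ + v` with `v` constant on the tight set of `w₀` and `λ = λ(q)` large is
admissible: its tight set on `COR(K_h)` is that of `w₀` (same free transversal) and its top generators are the LEXICOGRAPHIC `(w₀, v)`-tops.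
`exists_scale` produces `λ` over the finite index set `(Fin h → Bool) ⊕ (Fin (K'+1) × Fin (K+1))`. -/

/-- a SCALE SEPARATOR over a finite index type: `λ` with `n a < λ · d a` whenever `d a > 0`. -/
theorem exists_scale {α : Type*} [Fintype α] (d n : α → ℝ) : ∃ lam : ℝ, ∀ a, 0 < d a → n a < lam * d a := by
  refine ⟨1 + ∑ a, |n a / d a|, fun a hd => ?_⟩
  have h1 : |n a / d a| ≤ ∑ a, |n a / d a| :=
    Finset.single_le_sum (f := fun a => |n a / d a|) (fun a _ => abs_nonneg _) (Finset.mem_univ a)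
  have h2 : n a / d a ≤ |n a / d a| := le_abs_self _
  have h3 : n a / d a * d a = n a := div_mul_cancel₀ (n a) hd.ne'
  calc n a = n a / d a * d a := h3.symm
    _ < (1 + ∑ a, |n a / d a|) * d a := mul_lt_mul_of_pos_right (by linarith) hd

/-- ★ **TWO-SCALE FACES**: `w₀` valid (bound `M₀`) and free on `ι`, `v` CONSTANT (`= v₀`) on the tight set of `w₀`, `e` a re-indexing of the
LEXICOGRAPHIC `(w₀, v)`-top generators covering them up to equal points, the top sub-family read on `ι` in `X` ⇒ `q ∈ Face X`
(witness functional `λ • w₀ + v`, bound `λ M₀ + v₀`, `λ = λ(q)` from `exists_scale`). -/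
theorem face_of_twoScale {X : PClass} {h ℓ K K' : ℕ} (q : Fam h K) (hℓ : Nat.sqrt h ≤ ℓ) (ι : Fin ℓ ↪ Fin h)
    (w₀ v : Fin h × Fin h → ℝ) (M₀ v₀ : ℝ)
    (hval : ∀ b : Fin h → Bool, w₀ ⬝ᵥ corVec (⊤ : SimpleGraph (Fin h)) b ≤ M₀)
    (hfree : ∀ c : Fin ℓ → Bool, ∃ b : Fin h → Bool, w₀ ⬝ᵥ corVec (⊤ : SimpleGraph (Fin h)) b = M₀ ∧ b ∘ ι = c)
    (hv : ∀ b : Fin h → Bool, w₀ ⬝ᵥ corVec (⊤ : SimpleGraph (Fin h)) b = M₀ → v ⬝ᵥ corVec (⊤ : SimpleGraph (Fin h)) b = v₀)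
    (e : Fin (K' + 1) → Fin (K + 1))
    (he₁ : ∀ j' k, w₀ ⬝ᵥ q k < w₀ ⬝ᵥ q (e j') ∨ (w₀ ⬝ᵥ q k = w₀ ⬝ᵥ q (e j') ∧ v ⬝ᵥ q k ≤ v ⬝ᵥ q (e j')))
    (he₂ : ∀ j, (∀ k, w₀ ⬝ᵥ q k < w₀ ⬝ᵥ q j ∨ (w₀ ⬝ᵥ q k = w₀ ⬝ᵥ q j ∧ v ⬝ᵥ q k ≤ v ⬝ᵥ q j)) → ∃ j', q (e j') = q j)
    (hx : X ℓ K' (⇑(delRead ι) ∘ q ∘ e)) : Face X h K q := by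
  obtain ⟨lam, hlam⟩ := exists_scale
    (Sum.elim (fun b : Fin h → Bool => M₀ - w₀ ⬝ᵥ corVec (⊤ : SimpleGraph (Fin h)) b)
      (fun jk : Fin (K' + 1) × Fin (K + 1) => w₀ ⬝ᵥ q (e jk.1) - w₀ ⬝ᵥ q jk.2))
    (Sum.elim (fun b : Fin h → Bool => v ⬝ᵥ corVec (⊤ : SimpleGraph (Fin h)) b - v₀)
      (fun jk : Fin (K' + 1) × Fin (K + 1) => v ⬝ᵥ q jk.2 - v ⬝ᵥ q (e jk.1)))
  have hb : ∀ b : Fin h → Bool, w₀ ⬝ᵥ corVec (⊤ : SimpleGraph (Fin h)) b < M₀ →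
      v ⬝ᵥ corVec (⊤ : SimpleGraph (Fin h)) b - v₀ < lam * M₀ - lam * (w₀ ⬝ᵥ corVec (⊤ : SimpleGraph (Fin h)) b) := by
    intro b hlt
    have h1 := hlam (Sum.inl b)
    simp only [Sum.elim_inl] at h1
    rw [mul_sub] at h1
    exact h1 (by linarith)
  have hjk : ∀ j' k, w₀ ⬝ᵥ q k < w₀ ⬝ᵥ q (e j') →
      v ⬝ᵥ q k - v ⬝ᵥ q (e j') < lam * (w₀ ⬝ᵥ q (e j')) - lam * (w₀ ⬝ᵥ q k) := by
    intro j' k hlt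
    have h1 := hlam (Sum.inr (j', k))
    simp only [Sum.elim_inr] at h1
    rw [mul_sub] at h1
    exact h1 (by linarith)
  have hwdot : ∀ y : Fin h × Fin h → ℝ, (lam • w₀ + v) ⬝ᵥ y = lam * (w₀ ⬝ᵥ y) + v ⬝ᵥ y := fun y => by
    rw [add_dotProduct, smul_dotProduct, smul_eq_mul]
  have htop : ∀ j' k, (lam • w₀ + v) ⬝ᵥ q k ≤ (lam • w₀ + v) ⬝ᵥ q (e j') := by
    intro j' k
    rw [hwdot, hwdot]
    rcases he₁ j' k with h1 | ⟨h1, h2⟩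
    · have h3 := hjk j' k h1
      linarith
    · rw [h1]
      linarith
  refine ⟨ℓ, hℓ, ι, lam • w₀ + v, lam * M₀ + v₀, fun b => ?_, fun c => ?_, K', e, htop, fun j hj => ?_, hx⟩
  · rw [hwdot]
    rcases (hval b).lt_or_eq with h1 | h1
    · have h3 := hb b h1
      linarith
    · rw [h1, hv b h1]
  · obtain ⟨b, hb1, hb2⟩ := hfree c
    exact ⟨b, by rw [hwdot, hb1, hv b hb1], hb2⟩
  · have e0j : (lam • w₀ + v) ⬝ᵥ q j = (lam • w₀ + v) ⬝ᵥ q (e 0) := le_antisymm (htop 0 j) (hj (e 0))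
    rw [hwdot, hwdot] at e0j
    have hw₀ : w₀ ⬝ᵥ q j = w₀ ⬝ᵥ q (e 0) := by
      rcases he₁ 0 j with h1 | ⟨h1, _⟩
      · exfalso
        have h3 := hjk 0 j h1
        linarith
      · exact h1
    have hvj : v ⬝ᵥ q j = v ⬝ᵥ q (e 0) := by
      rw [hw₀] at e0j
      linarith
    refine he₂ j fun k => ?_
    rcases he₁ 0 k with h1 | ⟨h1, h2⟩
    · exact Or.inl (by rw [hw₀]; exact h1)
    · exact Or.inr ⟨by rw [hw₀]; exact h1, by rw [hvj]; exact h2⟩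

/-- ★ **TWO-SCALE UNIQUE TOP ⇒ `Face Quiet`** (the ELEVEN / TWELVE shape «lexicographic unique top on a free face», literally an instance). -/
theorem faceQuiet_of_twoScaleTop {h ℓ K : ℕ} (q : Fam h K) (hℓ : Nat.sqrt h ≤ ℓ) (ι : Fin ℓ ↪ Fin h)
    (w₀ v : Fin h × Fin h → ℝ) (M₀ v₀ : ℝ)
    (hval : ∀ b : Fin h → Bool, w₀ ⬝ᵥ corVec (⊤ : SimpleGraph (Fin h)) b ≤ M₀)
    (hfree : ∀ c : Fin ℓ → Bool, ∃ b : Fin h → Bool, w₀ ⬝ᵥ corVec (⊤ : SimpleGraph (Fin h)) b = M₀ ∧ b ∘ ι = c)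
    (hv : ∀ b : Fin h → Bool, w₀ ⬝ᵥ corVec (⊤ : SimpleGraph (Fin h)) b = M₀ → v ⬝ᵥ corVec (⊤ : SimpleGraph (Fin h)) b = v₀)
    (j₀ : Fin (K + 1))
    (htop : ∀ j, (w₀ ⬝ᵥ q j < w₀ ⬝ᵥ q j₀ ∨ (w₀ ⬝ᵥ q j = w₀ ⬝ᵥ q j₀ ∧ v ⬝ᵥ q j < v ⬝ᵥ q j₀)) ∨ q j = q j₀) :
    Face Quiet h K q := by
  refine face_of_twoScale (K' := 0) q hℓ ι w₀ v M₀ v₀ hval hfree hv (fun _ => j₀) (fun _ k => ?_) (fun j hj => ?_)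
    (fun j => rfl)
  · rcases htop k with (h1 | ⟨h1, h2⟩) | h1
    · exact Or.inl h1
    · exact Or.inr ⟨h1, h2.le⟩
    · rw [h1]
      exact Or.inr ⟨rfl, le_rfl⟩
  · rcases htop j with (h1 | ⟨h1, h2⟩) | h1
    · exfalso
      rcases hj j₀ with h3 | ⟨h3, _⟩
      · exact lt_asymm h1 h3
      · exact h1.ne h3.symm
    · exfalso
      rcases hj j₀ with h3 | ⟨_, h4⟩
      · exact h3.ne h1.symm
      · exact not_le.2 h2 h4
    · exact ⟨0, h1.symm⟩

/-! ### §B4 The composite `Face ∘ AutStar` (every minor of `K_{h+1}`, deletion or contraction, after every symmetry word) -/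

/-- ★★ the composite: `Face ∘ AutStar` of a decided class is decided (every minor of `K_{h+1}` — deletion or contraction — after every
symmetry word, for every face-top sub-family). -/
theorem decided_face_autStar {X : PClass} (hX : Decided X) : Decided (Face (AutStar X)) :=
  decided_face (decided_autStar hX)

/-- ★★★ **GLUE (strongest form of this file)** — `CoreLawFace`-shape: the residual law outside `Face (AutStar X)` suffices. -/
theorem corVirtualHard_of_residualLawFaceAutStar {X : PClass} (hX : Decided X) (hR : ResidualLaw (Face (AutStar X))) :
    CorVirtualHard :=
  corVirtualHard_of_residualLaw (decided_face_autStar hX) hR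

/-- and it is weaker than the `OrbStar` form the pen uses (`OrbStar X ≤ AutStar X ≤ Face (AutStar X)`). -/
theorem residualLaw_faceAutStar_of_orbStar {X : PClass} (hR : ResidualLaw (OrbStar X)) : ResidualLaw (Face (AutStar X)) :=
  residualLaw_anti (fun _ _ _ hq => le_face (orbStar_le_autStar hq)) hR


end Summit.ValiantsHypothesis.ValiantsHypothesis.Theorems.FifoMatching.Localization
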